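import Literature.Analysis.FluidPDE.DuchonRobertLocalBalance
import Literature.Analysis.FluidPDE.OnsagerCCFSTestField
import Literature.Analysis.FluidPDE.CoarseGrainingEstimates
import Literature.Analysis.FunctionSpaces.TorusMollifierEstimates
import HarnessLib

/-!
# Duchon–Robert's cubic identity — discharge of `Torus.integral_kernelFlux_mul_eq`

Sorry-free proof `Torus.integral_kernelFlux_mul_eq_holds` of the first named step fact of
`Literature.Analysis.FluidPDE.DuchonRobertLocalBalance` (the decomposition of Duchon–Robert 2000,
Prop. 1–2): the **cubic identity** of the proof of Prop. 1 (pp. 250–251), which turns the flux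
`∫ ∇φ^ε(ξ)·δu |δu|² dξ` — here in its torus form `𝒟_K(u)(x) = ∫_{T^d} ⟪∇K(z), δu(x;z)⟫|δu(x;z)|² dz`
(`Torus.kernelFlux`) for a smooth even kernel `K` — tested against `ψ`, into mollified transport
terms plus the convective pairing of the symmetric field `Φ = ψ u^K + (ψu) ⋆ K`
(`Torus.symmTestField`):
`∫₀ᵀ∫ 𝒟_K(u)ψ = ∫₀ᵀ∫⟪(|u|²u) ⋆ K, ∇ψ⟫ − ∫₀ᵀ∫(|u|² ⋆ K)⟪u,∇ψ⟫ + 2∫₀ᵀ∫⟪u,u ⋆ K⟫⟪u,∇ψ⟫ − 2∫₀ᵀ∫⟪u,(u·∇)Φ⟫`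
for jointly measurable `u ∈ L³((0,T) × T^d)` weakly divergence free for a.e. `t`.

## The proof

* **Kernel calculus** (`integral_inner_gradient_translate`): for `F ∈ L¹(T^d; ℝ^d)` and a smooth
  even `K`, `∫ ⟪∇K(z), F(x + z)⟫ dz = -div(F ⋆ K)(x) = -∑ⱼ (Fⱼ ⋆ ∂ⱼK)(x)` (translation
  invariance, oddness of `∇K`, `∂ⱼ(Fⱼ ⋆ K) = Fⱼ ⋆ ∂ⱼK`).
* **Pointwise identity** (`kernelFlux_eq_sum`): expanding `(δu)ⱼ|δu|²` in the six monomials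
  `|a|²a, ⟪a,b⟫a, |b|²a, |a|²b, ⟪a,b⟫b, |b|²b` (`a = u(x+z)`, `b = u(x)`) and integrating each
  against `∇K`:
  `𝒟_K(u)(x) = -∑ⱼ((|u|²uⱼ) ⋆ ∂ⱼK)(x) + 2∑ᵢⱼ uᵢ(x)((uᵢuⱼ) ⋆ ∂ⱼK)(x) + ⟪u(x), ∇(|u|² ⋆ K)(x)⟫ − 2∑ᵢⱼ uᵢ(x)uⱼ(x)∂ⱼ(uᵢ ⋆ K)(x)`,
  the `|b|²a` term vanishing by `∑ⱼ uⱼ ⋆ ∂ⱼK = 0` (weak divergence-freeness,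
  `Torus.sum_convolution_partialDeriv_eq_zero`) and the `|b|²b` term by `∫ ∂ⱼK = 0`.
* **Slice identity** (`integral_kernelFlux_mul_slice`): integrate against a smooth `χ`;
  integration by parts for the first term (`Torus.integral_inner_gradient_eq_neg_integral_mul_divergence_holds`),
  the odd adjointness `∫ f (g ⋆ ∂ⱼK) = -∫ (f ⋆ ∂ⱼK) g` (`integral_mul_convolution_odd`) for the
  second, weak divergence-freeness against `(|u|² ⋆ K)χ` for the third, and the coordinate expansion
  `⟪u,(u·∇)Φ⟫ = ⟪u,u^K⟫⟪u,∇χ⟫ + ∑ᵢⱼ uᵢuⱼ[χ∂ⱼ(uᵢ ⋆ K) + ∂ⱼ((χuᵢ) ⋆ K)]`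
  (`inner_convect_eq_sum`, `partialDeriv_symmTestField`).
* **Space–time** (`integral_kernelFlux_mul_eq_holds`): the slice identity for a.e. `t`, and Fubini;
  the four product integrands are integrable by the dominations `∫|u(t)|³`,
  `(∫|u(t)|²)|u(t,x)|`, `(∫|u(t)|)|u(t,x)|²` (`integrable_slice_dominations`, Lyapunov's
  inequality `(∫|f|²)(∫|f|) ≤ ∫|f|³` on the probability space `T^d`) and
  `|𝒟_K(u)(x)| ≤ 4‖∇K‖_∞ (∫|u(t)|³ + |u(t,x)|³)` (`abs_kernelFlux_le`); the convective slice
  functional is then integrable in time as the a.e. linear combination given by the slice identity.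

## Sources

* J. Duchon, R. Robert, Nonlinearity 13 (2000) 249–255, proof of Prop. 1, pp. 250–251 (the cubic
  computation; locators as recorded in `DuchonRobertInviscidLimit`). [DuchonRobert2000]
* L. C. Evans, *Partial Differential Equations*, 2nd ed. (2010), App. C.4 Thm. 7 (i), App. C.2
  Thm. 2 (derivatives of mollifications; integration by parts). [Evans2010]

## Mathlib / tree

Mathlib: group convolution and `integral_add_left_eq_self` (translation invariance of Haar
integrals), `PiLp.hasFDerivAt_apply`, `eLpNorm_le_eLpNorm_of_exponent_le`, Fubini
(`integral_integral_swap`, `Integrable.integral_prod_left`, `lintegral_prod`). Tree: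
`TorusConvolution` (`partialDeriv_convolution`, `gradient_comp_sub_left`, `norm_convolution_le`,
`aestronglyMeasurable_uncurry_convolution`), `TorusSpaceTimeConvolution`
(`finset_sum_convolution`), `OnsagerCCFSTestField` (`sum_convolution_partialDeriv_eq_zero`,
`ae_memLp_three_of_lintegral`), `OnsagerCCFSFlux` (`vecConv`,
`aestronglyMeasurable_uncurry_vecConv`), `DuchonRobertShellLaw` (`aestronglyMeasurable_translate`,
`norm_sub_pow_three_le`, `integrable_norm_pow_three`), `TorusCalculusProofs`.
-/

noncomputable section

open MeasureTheory TopologicalSpace Set Function Filter Topology Metric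
open scoped ENNReal NNReal Convolution ContDiff InnerProductSpace RealInnerProductSpace

namespace Literature.Analysis.FluidPDE.Torus

variable {d : Type*} [Fintype d] [DecidableEq d]


section KernelCalculus

variable {K : UnitAddTorus d → ℝ}

omit [DecidableEq d] in
/-- The gradient of an even function on `T^d` is odd: `∇K(-z) = -∇K(z)` (no differentiability
needed: `Torus.gradient_comp_sub_left` at the base point `0`). [folklore] -/
theorem gradient_neg_of_even (hKev : ∀ z, K (-z) = K z) (z : UnitAddTorus d) :
    FunctionSpaces.Torus.gradient K (-z) = -FunctionSpaces.Torus.gradient K z := by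
  have h := FunctionSpaces.Torus.gradient_comp_sub_left K 0 z
  have hfun : (fun y : UnitAddTorus d => K (0 - y)) = K := by
    funext y
    rw [zero_sub, hKev]
  rw [hfun, zero_sub] at h
  rw [h, neg_neg]

omit [DecidableEq d] in
/-- Componentwise smoothness of the mollification of an integrable vector field by a smooth
kernel (`Torus.isSmooth_convolution` in each coordinate). [folklore] -/
theorem isSmooth_vecConv {F : UnitAddTorus d → EuclideanSpace ℝ d} (hF : Integrable F volume)
    (hK : FunctionSpaces.Torus.IsSmooth K) : FunctionSpaces.Torus.IsSmooth (vecConv F K) := by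
  rw [FunctionSpaces.Torus.IsSmooth, contDiff_euclidean]
  intro i
  exact FunctionSpaces.Torus.isSmooth_convolution (hF.eval_piLp i) hK

omit [DecidableEq d] in
/-- The kernel-weighted translate pairing is integrable: `z ↦ ⟪∇K(z), F(x + z)⟫` for `F ∈ L¹`
and smooth `K` (bounded gradient, translation invariance of Haar measure). [folklore] -/
theorem integrable_inner_gradient_translate (hK : FunctionSpaces.Torus.IsSmooth K)
    {F : UnitAddTorus d → EuclideanSpace ℝ d} (hF : Integrable F volume) (x : UnitAddTorus d) :
    Integrable (fun z => ⟪FunctionSpaces.Torus.gradient K z, F (x + z)⟫) volume := by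
  obtain ⟨C, hC⟩ := FunctionSpaces.Torus.exists_forall_norm_le_of_continuous hK.gradient.continuous
  have hFx : Integrable (fun z => F (x + z)) volume := hF.comp_add_left x
  refine (hFx.norm.const_mul C).mono'
    (hK.gradient.continuous.aestronglyMeasurable.inner hFx.aestronglyMeasurable)
    (ae_of_all _ fun z => ?_)
  exact (norm_inner_le_norm _ _).trans (mul_le_mul_of_nonneg_right (hC z) (norm_nonneg _))

/-- **The kernel identity**: for a smooth even kernel `K` and `F ∈ L¹(T^d; ℝ^d)`,
`∫ ⟪∇K(z), F(x + z)⟫ dz = -div(F ⋆ K)(x)` (componentwise mollification `Torus.vecConv`):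
substitute `y = x + z`, use oddness of `∇K` and `∂ⱼ(Fⱼ ⋆ K) = Fⱼ ⋆ ∂ⱼK`. [folklore] -/
theorem integral_inner_gradient_translate (hK : FunctionSpaces.Torus.IsSmooth K)
    (hKev : ∀ z, K (-z) = K z) {F : UnitAddTorus d → EuclideanSpace ℝ d} (hF : Integrable F volume)
    (x : UnitAddTorus d) :
    ∫ z, ⟪FunctionSpaces.Torus.gradient K z, F (x + z)⟫ =
      -FunctionSpaces.Torus.divergence (vecConv F K) x := by
  have hK1 : FunctionSpaces.Torus.IsContDiff 1 K := hK.isContDiff (by simp)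
  have hFi : ∀ i, Integrable (fun y => F y i) volume := fun i => hF.eval_piLp i
  -- substitute `y = x + z`
  have hsub : (∫ z, ⟪FunctionSpaces.Torus.gradient K z, F (x + z)⟫) =
      ∫ y, ⟪FunctionSpaces.Torus.gradient K (y - x), F y⟫ := by
    rw [← integral_add_left_eq_self (μ := (volume : Measure (UnitAddTorus d)))
      (fun y => ⟪FunctionSpaces.Torus.gradient K (y - x), F y⟫) x]
    refine integral_congr_ae (ae_of_all _ fun z => ?_)
    simp only [add_sub_cancel_left]
  rw [hsub]
  -- the right-hand side in coordinates
  have hdiv : FunctionSpaces.Torus.divergence (vecConv F K) x =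
      ∑ j, ∫ y, F y j * FunctionSpaces.Torus.partialDeriv j K (x - y) := by
    unfold FunctionSpaces.Torus.divergence
    refine Finset.sum_congr rfl fun j _ => ?_
    have hfun : (fun y => vecConv F K y j) = ((fun y => F y j) ⋆ K) := by
      funext y
      rfl
    rw [hfun, FunctionSpaces.Torus.partialDeriv_convolution (hFi j) hK, convolution_lsmul]
    rfl
  -- the left-hand side in coordinates
  have hpt : ∀ y, ⟪FunctionSpaces.Torus.gradient K (y - x), F y⟫ =
      -∑ j, F y j * FunctionSpaces.Torus.partialDeriv j K (x - y) := by
    intro y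
    rw [← neg_sub x y, gradient_neg_of_even hKev, inner_neg_left,
      FunctionSpaces.Torus.gradient_eq_sum_partialDeriv hK1, sum_inner]
    congr 1
    refine Finset.sum_congr rfl fun j _ => ?_
    rw [real_inner_smul_left, EuclideanSpace.inner_single_left]
    simp [mul_comm]
  have hint : ∀ j, Integrable (fun y => F y j * FunctionSpaces.Torus.partialDeriv j K (x - y)) volume :=
    fun j => FunctionSpaces.Torus.integrable_smul_comp_sub (hFi j) (hK.partialDeriv j).continuous x
  simp_rw [hpt]
  rw [integral_neg, integral_finsetSum _ fun j _ => hint j, hdiv]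

end KernelCalculus

section Pointwise

variable {K : UnitAddTorus d → ℝ} {v : UnitAddTorus d → EuclideanSpace ℝ d}

omit [DecidableEq d] in
/-- Pulling a constant out of the rough factor of a mollification. [folklore] -/
theorem const_mul_convolution (c : ℝ) (f L : UnitAddTorus d → ℝ) (x : UnitAddTorus d) :
    ((fun y => c * f y) ⋆ L) x = c * (f ⋆ L) x := by
  rw [convolution_lsmul, convolution_lsmul, ← integral_const_mul]
  refine integral_congr_ae (ae_of_all _ fun y => ?_)
  simp only [smul_eq_mul]
  ring

omit [DecidableEq d] in
/-- The mollification of a constant by a derivative kernel vanishes when the kernel has zero mean: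
`(c ⋆ L)(x) = c ∫ L`. [folklore] -/
theorem const_convolution (c : ℝ) (L : UnitAddTorus d → ℝ) (x : UnitAddTorus d) :
    ((fun _ => c) ⋆ L) x = c * ∫ y, L y := by
  rw [FunctionSpaces.Torus.convolution_comm_real, convolution_lsmul, ← integral_const_mul]
  refine integral_congr_ae (ae_of_all _ fun y => ?_)
  simp only [smul_eq_mul]
  ring

/-- The kernel identity in coordinates: `∫ ⟪∇K(z), F(x + z)⟫ dz = -∑ⱼ (Fⱼ ⋆ ∂ⱼK)(x)`. [folklore] -/
theorem integral_inner_gradient_translate_eq_sum (hK : FunctionSpaces.Torus.IsSmooth K)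
    (hKev : ∀ z, K (-z) = K z) {F : UnitAddTorus d → EuclideanSpace ℝ d} (hF : Integrable F volume)
    (x : UnitAddTorus d) :
    ∫ z, ⟪FunctionSpaces.Torus.gradient K z, F (x + z)⟫ =
      -∑ j, ((fun y => F y j) ⋆ FunctionSpaces.Torus.partialDeriv j K) x := by
  rw [integral_inner_gradient_translate hK hKev hF, FunctionSpaces.Torus.divergence]
  congr 1
  refine Finset.sum_congr rfl fun j _ => ?_
  have hfun : (fun y => vecConv F K y j) = ((fun y => F y j) ⋆ K) := by
    funext y
    rfl
  rw [hfun, FunctionSpaces.Torus.partialDeriv_convolution (hF.eval_piLp j) hK]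

omit [DecidableEq d] in
/-- Cubes and squares of an `L³` field on the torus are integrable. [folklore] -/
theorem MemLp.integrable_norm_pow_three_and_sq (hv : MemLp v 3 volume) :
    Integrable (fun y => ‖v y‖ ^ 3) volume ∧ Integrable (fun y => ‖v y‖ ^ 2) volume ∧
      Integrable v volume := by
  refine ⟨?_, ?_, hv.integrable (by norm_num)⟩
  · have h := hv.integrable_norm_rpow three_ne_zero ENNReal.ofNat_ne_top
    refine h.congr (ae_of_all _ fun y => ?_)
    rw [ENNReal.toReal_ofNat]
    exact Real.rpow_natCast _ 3
  · exact (memLp_two_iff_integrable_sq_norm hv.1).1 (hv.mono_exponent (by norm_num))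

omit [DecidableEq d] in
/-- Products of two coordinates of an `L³` (indeed `L²`) field are integrable. [folklore] -/
theorem integrable_apply_mul_apply (hvm : AEStronglyMeasurable v volume)
    (I2 : Integrable (fun y => ‖v y‖ ^ 2) volume) (i j : d) :
    Integrable (fun y => v y i * v y j) volume := by
  have hmi : ∀ k, AEStronglyMeasurable (fun y => v y k) volume := fun k =>
    (EuclideanSpace.proj (𝕜 := ℝ) k).continuous.comp_aestronglyMeasurable hvm
  refine I2.mono' ((hmi i).mul (hmi j)) (ae_of_all _ fun y => ?_)
  rw [norm_mul]
  have hi := PiLp.norm_apply_le (v y) i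
  have hj := PiLp.norm_apply_le (v y) j
  calc ‖v y i‖ * ‖v y j‖ ≤ ‖v y‖ * ‖v y‖ := mul_le_mul hi hj (norm_nonneg _) (norm_nonneg _)
    _ = ‖v y‖ ^ 2 := by ring

/-- **Duchon–Robert's cubic identity, pointwise**: for a smooth even kernel `K`, an `L³` weakly
divergence-free field `v` and every `x`,
`𝒟_K(v)(x) = -∑ⱼ((|v|²vⱼ) ⋆ ∂ⱼK)(x) + 2∑ᵢⱼ vᵢ(x)((vᵢvⱼ) ⋆ ∂ⱼK)(x) + ⟪v(x), ∇(|v|² ⋆ K)(x)⟫ − 2∑ᵢⱼ vᵢ(x)vⱼ(x)∂ⱼ(vᵢ ⋆ K)(x)`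
(expand `(δv)ⱼ|δv|²` in the six monomials `|a|²a, ⟪a,b⟫a, |b|²a, |a|²b, ⟪a,b⟫b, |b|²b` of
`a = v(x+z)`, `b = v(x)`, integrate each against `∇K` by the kernel identity, and use
`∑ⱼ vⱼ ⋆ ∂ⱼK = 0`, `∫ ∂ⱼK = 0`; Duchon–Robert 2000, proof of Prop. 1, pp. 250–251). [cite: DuchonRobert2000, proof of Prop. 1 pp. 250–251] -/
theorem kernelFlux_eq_sum (hK : FunctionSpaces.Torus.IsSmooth K) (hKev : ∀ z, K (-z) = K z)
    (hv : MemLp v 3 volume) (hdiv : FunctionSpaces.Torus.IsWeaklyDivFree v) (x : UnitAddTorus d) :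
    kernelFlux K v x =
      -(∑ j, ((fun y => ‖v y‖ ^ 2 * v y j) ⋆ FunctionSpaces.Torus.partialDeriv j K) x) +
      2 * (∑ i, ∑ j, v x i * ((fun y => v y i * v y j) ⋆ FunctionSpaces.Torus.partialDeriv j K) x) +
      ⟪v x, FunctionSpaces.Torus.gradient ((fun y => ‖v y‖ ^ 2) ⋆ K) x⟫ -
      2 * ∑ i, ∑ j, v x i * v x j *
        FunctionSpaces.Torus.partialDeriv j ((fun y => v y i) ⋆ K) x := by
  obtain ⟨I3, I2, I1⟩ := MemLp.integrable_norm_pow_three_and_sq hv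
  have hK1 : FunctionSpaces.Torus.IsContDiff 1 K := hK.isContDiff (by simp)
  set b : EuclideanSpace ℝ d := v x with hb
  -- the six monomials, as integrable vector fields of `y = x + z`
  set G₁ : UnitAddTorus d → EuclideanSpace ℝ d := fun y => ‖v y‖ ^ 2 • v y with hG₁
  set G₂ : UnitAddTorus d → EuclideanSpace ℝ d := fun y => ⟪v y, b⟫ • v y with hG₂
  set G₃ : UnitAddTorus d → EuclideanSpace ℝ d := fun y => ‖b‖ ^ 2 • v y with hG₃
  set G₄ : UnitAddTorus d → EuclideanSpace ℝ d := fun y => ‖v y‖ ^ 2 • b with hG₄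
  set G₅ : UnitAddTorus d → EuclideanSpace ℝ d := fun y => ⟪v y, b⟫ • b with hG₅
  set G₆ : UnitAddTorus d → EuclideanSpace ℝ d := fun _ => ‖b‖ ^ 2 • b with hG₆
  have iG₁ : Integrable G₁ volume := by
    refine I3.mono' ((hv.1.norm.pow 2).smul hv.1) (ae_of_all _ fun y => le_of_eq ?_)
    rw [hG₁, norm_smul, Real.norm_eq_abs, abs_of_nonneg (sq_nonneg _)]
    ring
  have iG₂ : Integrable G₂ volume := by
    have hm : AEStronglyMeasurable (fun y => ⟪v y, b⟫ • v y) volume := by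
      exact (hv.1.inner (𝕜 := ℝ) (aestronglyMeasurable_const (b := b))).smul hv.1
    refine (I2.const_mul ‖b‖).mono' hm (ae_of_all _ fun y => ?_)
    rw [hG₂, norm_smul, Real.norm_eq_abs]
    calc |⟪v y, b⟫| * ‖v y‖ ≤ (‖v y‖ * ‖b‖) * ‖v y‖ :=
          mul_le_mul_of_nonneg_right (abs_real_inner_le_norm _ _) (norm_nonneg _)
      _ = ‖b‖ * ‖v y‖ ^ 2 := by ring
  have iG₃ : Integrable G₃ volume := I1.smul (‖b‖ ^ 2)
  have iG₄ : Integrable G₄ volume := I2.smul_const b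
  have iG₅ : Integrable G₅ volume := (I1.inner_const b).smul_const b
  have iG₆ : Integrable G₆ volume := integrable_const _
  -- expansion of the integrand
  have hpt : ∀ z, ⟪FunctionSpaces.Torus.gradient K z, v (x + z) - v x⟫ * ‖v (x + z) - v x‖ ^ 2 =
      ⟪FunctionSpaces.Torus.gradient K z, G₁ (x + z)⟫ - 2 * ⟪FunctionSpaces.Torus.gradient K z, G₂ (x + z)⟫ +
        ⟪FunctionSpaces.Torus.gradient K z, G₃ (x + z)⟫ - ⟪FunctionSpaces.Torus.gradient K z, G₄ (x + z)⟫ +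
        2 * ⟪FunctionSpaces.Torus.gradient K z, G₅ (x + z)⟫ - ⟪FunctionSpaces.Torus.gradient K z, G₆ (x + z)⟫ := by
    intro z
    simp only [hG₁, hG₂, hG₃, hG₄, hG₅, hG₆, real_inner_smul_right, inner_sub_right,
      norm_sub_sq_real]
    ring
  -- evaluate each term by the kernel identity
  have e : ∀ {G : UnitAddTorus d → EuclideanSpace ℝ d}, Integrable G volume →
      ∫ z, ⟪FunctionSpaces.Torus.gradient K z, G (x + z)⟫ =
        -∑ j, ((fun y => G y j) ⋆ FunctionSpaces.Torus.partialDeriv j K) x :=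
    fun hG => integral_inner_gradient_translate_eq_sum hK hKev hG x
  have f : ∀ {G : UnitAddTorus d → EuclideanSpace ℝ d}, Integrable G volume →
      Integrable (fun z => ⟪FunctionSpaces.Torus.gradient K z, G (x + z)⟫) volume :=
    fun hG => integrable_inner_gradient_translate hK hG x
  -- integrability of the partial sums (lambda form) and splitting
  have h12 : Integrable (fun z => ⟪FunctionSpaces.Torus.gradient K z, G₁ (x + z)⟫ -
      2 * ⟪FunctionSpaces.Torus.gradient K z, G₂ (x + z)⟫) volume := (f iG₁).sub ((f iG₂).const_mul 2)
  have h123 : Integrable (fun z => ⟪FunctionSpaces.Torus.gradient K z, G₁ (x + z)⟫ -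
      2 * ⟪FunctionSpaces.Torus.gradient K z, G₂ (x + z)⟫ +
      ⟪FunctionSpaces.Torus.gradient K z, G₃ (x + z)⟫) volume := h12.add (f iG₃)
  have h1234 : Integrable (fun z => ⟪FunctionSpaces.Torus.gradient K z, G₁ (x + z)⟫ -
      2 * ⟪FunctionSpaces.Torus.gradient K z, G₂ (x + z)⟫ +
      ⟪FunctionSpaces.Torus.gradient K z, G₃ (x + z)⟫ -
      ⟪FunctionSpaces.Torus.gradient K z, G₄ (x + z)⟫) volume := h123.sub (f iG₄)
  have h12345 : Integrable (fun z => ⟪FunctionSpaces.Torus.gradient K z, G₁ (x + z)⟫ -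
      2 * ⟪FunctionSpaces.Torus.gradient K z, G₂ (x + z)⟫ +
      ⟪FunctionSpaces.Torus.gradient K z, G₃ (x + z)⟫ -
      ⟪FunctionSpaces.Torus.gradient K z, G₄ (x + z)⟫ +
      2 * ⟪FunctionSpaces.Torus.gradient K z, G₅ (x + z)⟫) volume := h1234.add ((f iG₅).const_mul 2)
  rw [kernelFlux]
  simp_rw [hpt]
  rw [integral_sub h12345 (f iG₆), integral_add h1234 ((f iG₅).const_mul 2),
    integral_sub h123 (f iG₄), integral_add h12 (f iG₃), integral_sub (f iG₁) ((f iG₂).const_mul 2),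
    integral_const_mul, integral_const_mul, e iG₁, e iG₂, e iG₃, e iG₄, e iG₅, e iG₆]
  -- identify the six coordinate sums
  have hvi : ∀ i, Integrable (fun y => v y i) volume := fun i => I1.eval_piLp i
  have hprod : ∀ i j, Integrable (fun y => v y i * v y j) volume :=
    fun i j => integrable_apply_mul_apply hv.1 I2 i j
  have hcont : ∀ j, Continuous (FunctionSpaces.Torus.partialDeriv j K) := fun j =>
    (hK.partialDeriv j).continuous
  have t1 : ∀ j, (fun y => G₁ y j) = fun y => ‖v y‖ ^ 2 * v y j := fun j => by
    funext y; simp [hG₁]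
  have t2 : ∀ j, ((fun y => G₂ y j) ⋆ FunctionSpaces.Torus.partialDeriv j K) x =
      ∑ i, b i * ((fun y => v y i * v y j) ⋆ FunctionSpaces.Torus.partialDeriv j K) x := by
    intro j
    have hfun : (fun y => G₂ y j) = fun y => ∑ i, b i * (v y i * v y j) := by
      funext y
      simp only [hG₂, PiLp.smul_apply, smul_eq_mul, inner_eq_sum_mul, Finset.sum_mul]
      exact Finset.sum_congr rfl fun i _ => by ring
    rw [hfun, FunctionSpaces.Torus.finset_sum_convolution _ (fun i _ => (hprod i j).const_mul _) (hcont j)]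
    exact Finset.sum_congr rfl fun i _ => const_mul_convolution _ _ _ _
  have t3 : ∑ j, ((fun y => G₃ y j) ⋆ FunctionSpaces.Torus.partialDeriv j K) x = 0 := by
    have hfun : ∀ j, (fun y => G₃ y j) = fun y => ‖b‖ ^ 2 * v y j := fun j => by
      funext y; simp [hG₃]
    simp_rw [hfun, const_mul_convolution]
    rw [← Finset.mul_sum, sum_convolution_partialDeriv_eq_zero I1 hdiv hK x, mul_zero]
  have t4 : ∑ j, ((fun y => G₄ y j) ⋆ FunctionSpaces.Torus.partialDeriv j K) x =
      ⟪b, FunctionSpaces.Torus.gradient ((fun y => ‖v y‖ ^ 2) ⋆ K) x⟫ := by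
    have hfun : ∀ j, (fun y => G₄ y j) = fun y => b j * ‖v y‖ ^ 2 := fun j => by
      funext y; simp [hG₄, mul_comm]
    simp_rw [hfun, const_mul_convolution]
    rw [inner_eq_sum_mul]
    refine Finset.sum_congr rfl fun j _ => ?_
    rw [FunctionSpaces.Torus.gradient_apply
        ((FunctionSpaces.Torus.isSmooth_convolution I2 hK).isContDiff (by simp)),
      FunctionSpaces.Torus.partialDeriv_convolution I2 hK]
  have t5 : ∑ j, ((fun y => G₅ y j) ⋆ FunctionSpaces.Torus.partialDeriv j K) x =
      ∑ i, ∑ j, b i * b j * FunctionSpaces.Torus.partialDeriv j ((fun y => v y i) ⋆ K) x := by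
    have hfun : ∀ j, (fun y => G₅ y j) = fun y => ∑ i, (b i * b j) * v y i := fun j => by
      funext y
      simp only [hG₅, PiLp.smul_apply, smul_eq_mul, inner_eq_sum_mul, Finset.sum_mul]
      exact Finset.sum_congr rfl fun i _ => by ring
    have hj : ∀ j, ((fun y => ∑ i, (b i * b j) * v y i) ⋆ FunctionSpaces.Torus.partialDeriv j K) x =
        ∑ i, b i * b j * FunctionSpaces.Torus.partialDeriv j ((fun y => v y i) ⋆ K) x := by
      intro j
      rw [FunctionSpaces.Torus.finset_sum_convolution _ (fun i _ => (hvi i).const_mul _) (hcont j)]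
      refine Finset.sum_congr rfl fun i _ => ?_
      rw [const_mul_convolution, FunctionSpaces.Torus.partialDeriv_convolution (hvi i) hK]
    simp_rw [hfun, hj]
    exact Finset.sum_comm
  have t6 : ∑ j, ((fun y => G₆ y j) ⋆ FunctionSpaces.Torus.partialDeriv j K) x = 0 := by
    refine Finset.sum_eq_zero fun j _ => ?_
    have hfun : (fun y => G₆ y j) = fun _ => ‖b‖ ^ 2 * b j := by
      funext y; simp [hG₆]
    rw [hfun, const_convolution, FunctionSpaces.Torus.integral_partialDeriv_eq_zero_holds hK j, mul_zero]
  simp_rw [t1] 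
  rw [t3, t4, t6]
  simp_rw [t2]
  rw [t5, Finset.sum_comm]
  ring

end Pointwise

/-! ## Calculus of the symmetric test field and two adjointness lemmas -/

section SliceCalculus

variable {K : UnitAddTorus d → ℝ} {v : UnitAddTorus d → EuclideanSpace ℝ d} {χ : UnitAddTorus d → ℝ}

/-- The divergence of a mollified vector field in coordinates:
`div(F ⋆ K)(x) = ∑ⱼ (Fⱼ ⋆ ∂ⱼK)(x)` for `F ∈ L¹` and smooth `K`. [folklore] -/
theorem divergence_vecConv_eq_sum (hK : FunctionSpaces.Torus.IsSmooth K)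
    {F : UnitAddTorus d → EuclideanSpace ℝ d} (hF : Integrable F volume) (x : UnitAddTorus d) :
    FunctionSpaces.Torus.divergence (vecConv F K) x =
      ∑ j, ((fun y => F y j) ⋆ FunctionSpaces.Torus.partialDeriv j K) x := by
  unfold FunctionSpaces.Torus.divergence
  refine Finset.sum_congr rfl fun j _ => ?_
  have hfun : (fun y => vecConv F K y j) = ((fun y => F y j) ⋆ K) := by
    funext y
    rfl
  rw [hfun, FunctionSpaces.Torus.partialDeriv_convolution (hF.eval_piLp j) hK]

omit [DecidableEq d] in
/-- **Mollification by an odd kernel is antisymmetric**: `∫ f (g ⋆ L) = -∫ (f ⋆ L) g` for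
integrable real `f`, `g` and a continuous odd kernel `L` on `T^d` (Fubini on `T^d × T^d`; the odd
twin of `Torus.integral_mul_convolution_comm`). [folklore] -/
theorem integral_mul_convolution_odd {f g L : UnitAddTorus d → ℝ} (hf : Integrable f volume)
    (hg : Integrable g volume) (hL : Continuous L) (hLo : ∀ z, L (-z) = -L z) :
    ∫ x, f x * (g ⋆ L) x = -∫ y, (f ⋆ L) y * g y := by
  obtain ⟨C, hC⟩ := FunctionSpaces.Torus.exists_forall_norm_le_of_continuous hL
  set Φ : UnitAddTorus d × UnitAddTorus d → ℝ := fun p => f p.1 * g p.2 * L (p.1 - p.2) with hΦ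
  have hΦi : Integrable Φ (volume.prod volume) := by
    have hprod : Integrable (fun p : UnitAddTorus d × UnitAddTorus d => f p.1 * g p.2)
        (volume.prod volume) := hf.mul_prod hg
    refine hprod.mul_bdd (hL.comp_aestronglyMeasurable
      (measurable_fst.sub measurable_snd).aestronglyMeasurable) (Eventually.of_forall fun p => hC _)
      |>.congr (Eventually.of_forall fun p => ?_)
    simp only [hΦ]
    rfl
  calc ∫ x, f x * (g ⋆ L) x = ∫ x, ∫ y, Φ (x, y) := by
        refine integral_congr_ae (Eventually.of_forall fun x => ?_)
        show f x * (g ⋆ L) x = ∫ y, Φ (x, y)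
        rw [convolution_lsmul, ← integral_const_mul]
        refine integral_congr_ae (Eventually.of_forall fun y => ?_)
        simp only [hΦ, smul_eq_mul]
        ring
    _ = ∫ y, ∫ x, Φ (x, y) := integral_integral_swap hΦi
    _ = ∫ y, -((f ⋆ L) y * g y) := by
        refine integral_congr_ae (Eventually.of_forall fun y => ?_)
        show ∫ x, Φ (x, y) = -((f ⋆ L) y * g y)
        rw [convolution_lsmul, ← integral_mul_const, ← integral_neg]
        refine integral_congr_ae (Eventually.of_forall fun x => ?_)
        simp only [hΦ, smul_eq_mul]
        rw [show x - y = -(y - x) by abel, hLo]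
        ring
    _ = -∫ y, (f ⋆ L) y * g y := integral_neg _

/-- The partial derivatives of an even `C¹` kernel are odd. [folklore] -/
theorem partialDeriv_neg_of_even (hK1 : FunctionSpaces.Torus.IsContDiff 1 K)
    (hKev : ∀ z, K (-z) = K z) (j : d) (z : UnitAddTorus d) :
    FunctionSpaces.Torus.partialDeriv j K (-z) = -FunctionSpaces.Torus.partialDeriv j K z := by
  have h := FunctionSpaces.Torus.partialDeriv_comp_sub_left hK1 j 0 z
  have hfun : (fun y : UnitAddTorus d => K (0 - y)) = K := by
    funext y
    rw [zero_sub, hKev]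
  rw [hfun, zero_sub] at h
  rw [h, neg_neg]

omit [DecidableEq d] in
/-- The gradient of a product of `C¹` scalar functions on the torus (local copy of the tree's
`Torus.gradient_mul` of `PassiveScalarProofs`, not imported here). [folklore] -/
theorem gradient_mul_of_isContDiff {a c : UnitAddTorus d → ℝ} (ha : FunctionSpaces.Torus.IsContDiff 1 a)
    (hc : FunctionSpaces.Torus.IsContDiff 1 c) (x : UnitAddTorus d) :
    FunctionSpaces.Torus.gradient (fun y => a y * c y) x =
      a x • FunctionSpaces.Torus.gradient c x + c x • FunctionSpaces.Torus.gradient a x := by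
  refine ext_inner_right ℝ fun w => ?_
  rw [FunctionSpaces.Torus.inner_gradient_left, inner_add_left, real_inner_smul_left,
    real_inner_smul_left, FunctionSpaces.Torus.inner_gradient_left,
    FunctionSpaces.Torus.inner_gradient_left]
  have h := FunctionSpaces.Torus.fderiv_smul_apply (F := ℝ) ha hc x w
  simp only [smul_eq_mul] at h
  show (FunctionSpaces.Torus.fderiv (fun y => a y * c y) x) w = _
  rw [h]
  ring

omit [DecidableEq d] in
/-- Components of the torus derivative of a `C¹` vector field: `(DΦ(x) h)ⱼ = DΦⱼ(x) h`. [folklore] -/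
theorem fderiv_apply_apply_of_isContDiff {Φ : UnitAddTorus d → EuclideanSpace ℝ d}
    (hΦ : FunctionSpaces.Torus.IsContDiff 1 Φ) (x : UnitAddTorus d) (h : EuclideanSpace ℝ d) (j : d) :
    FunctionSpaces.Torus.fderiv Φ x h j = FunctionSpaces.Torus.fderiv (fun y => Φ y j) x h := by
  have hΦd : DifferentiableAt ℝ (FunctionSpaces.Torus.liftAt Φ x) 0 :=
    ((hΦ.liftAt x).differentiable one_ne_zero).differentiableAt
  have hcomp := ((PiLp.hasFDerivAt_apply (𝕜 := ℝ) 2 (FunctionSpaces.Torus.liftAt Φ x 0) j).comp 0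
    hΦd.hasFDerivAt).fderiv
  have hfun : FunctionSpaces.Torus.liftAt (fun y => Φ y j) x =
      (fun f : EuclideanSpace ℝ d => f j) ∘ FunctionSpaces.Torus.liftAt Φ x := rfl
  simp only [FunctionSpaces.Torus.fderiv]
  rw [hfun, hcomp]
  rfl

/-- The convective pairing in coordinates: `⟪w, (v·∇)Φ(x)⟫ = ∑ⱼ wⱼ ∑ᵢ vᵢ(x) ∂ᵢΦⱼ(x)` for a `C¹`
vector field `Φ` (general form of `Torus.inner_convect_vecField`; the component lemma is the
`C¹` form of `Torus.fderiv_apply_apply` of `OnsagerProofs`). [folklore] -/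
theorem inner_convect_eq_sum {Φ : UnitAddTorus d → EuclideanSpace ℝ d}
    (hΦ : FunctionSpaces.Torus.IsContDiff 1 Φ) (w : EuclideanSpace ℝ d)
    (v : UnitAddTorus d → EuclideanSpace ℝ d) (x : UnitAddTorus d) :
    ⟪w, FunctionSpaces.Torus.convect v Φ x⟫ =
      ∑ j, w j * ∑ i, v x i * FunctionSpaces.Torus.partialDeriv i (fun y => Φ y j) x := by
  rw [inner_eq_sum_mul]
  refine Finset.sum_congr rfl fun j _ => ?_
  have hj : FunctionSpaces.Torus.IsContDiff 1 (fun y => Φ y j) :=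
    (EuclideanSpace.proj (𝕜 := ℝ) j).contDiff.comp hΦ
  rw [FunctionSpaces.Torus.convect, fderiv_apply_apply_of_isContDiff hΦ,
    FunctionSpaces.Torus.fderiv_apply_eq_sum_partialDeriv hj]
  simp [smul_eq_mul]

omit [DecidableEq d] in
/-- The symmetric test field of an integrable field and a smooth kernel and cut-off is smooth. [folklore] -/
theorem isSmooth_symmTestField (hK : FunctionSpaces.Torus.IsSmooth K)
    (hχ : FunctionSpaces.Torus.IsSmooth χ) (hv : Integrable v volume) :
    FunctionSpaces.Torus.IsSmooth (symmTestField K χ v) := by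
  have h1 : FunctionSpaces.Torus.IsSmooth (vecConv v K) := isSmooth_vecConv hv hK
  have h2 : FunctionSpaces.Torus.IsSmooth (vecConv (fun y => χ y • v y) K) :=
    isSmooth_vecConv (hχ.integrable_smul hv) hK
  exact (hχ.smul' h1).add h2

omit [DecidableEq d] in
/-- The components of the symmetric test field: `Φⱼ = χ (vⱼ ⋆ K) + (χ vⱼ) ⋆ K`. [folklore] -/
theorem symmTestField_apply_apply (K χ : UnitAddTorus d → ℝ) (v : UnitAddTorus d → EuclideanSpace ℝ d)
    (y : UnitAddTorus d) (j : d) :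
    symmTestField K χ v y j = χ y * ((fun z => v z j) ⋆ K) y + ((fun z => χ z * v z j) ⋆ K) y := by
  rw [symmTestField_apply, PiLp.add_apply, PiLp.smul_apply, smul_eq_mul, vecConv_apply, vecConv_apply]
  rfl

/-- Partial derivatives of the components of the symmetric test field:
`∂ᵢΦⱼ = ∂ᵢχ (vⱼ ⋆ K) + χ ∂ᵢ(vⱼ ⋆ K) + ∂ᵢ((χ vⱼ) ⋆ K)`. [folklore] -/
theorem partialDeriv_symmTestField (hK : FunctionSpaces.Torus.IsSmooth K)
    (hχ : FunctionSpaces.Torus.IsSmooth χ) (hv : Integrable v volume) (i j : d) (x : UnitAddTorus d) :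
    FunctionSpaces.Torus.partialDeriv i (fun y => symmTestField K χ v y j) x =
      FunctionSpaces.Torus.partialDeriv i χ x * ((fun z => v z j) ⋆ K) x +
        χ x * FunctionSpaces.Torus.partialDeriv i ((fun z => v z j) ⋆ K) x +
        FunctionSpaces.Torus.partialDeriv i ((fun z => χ z * v z j) ⋆ K) x := by
  have hvj : Integrable (fun z => v z j) volume := hv.eval_piLp j
  have hχvj : Integrable (fun z => χ z * v z j) volume := hχ.integrable_smul hvj
  have hs1 : FunctionSpaces.Torus.IsSmooth ((fun z => v z j) ⋆ K) :=
    FunctionSpaces.Torus.isSmooth_convolution hvj hK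
  have hs2 : FunctionSpaces.Torus.IsSmooth ((fun z => χ z * v z j) ⋆ K) :=
    FunctionSpaces.Torus.isSmooth_convolution hχvj hK
  have hfun : (fun y => symmTestField K χ v y j) =
      (fun y => χ y * ((fun z => v z j) ⋆ K) y) + ((fun z => χ z * v z j) ⋆ K) := by
    funext y
    rw [Pi.add_apply, symmTestField_apply_apply]
  have hm : FunctionSpaces.Torus.IsContDiff 1 (fun y => χ y * ((fun z => v z j) ⋆ K) y) :=
    (hχ.smul' hs1).isContDiff (by simp)
  rw [hfun, FunctionSpaces.Torus.partialDeriv_add hm (hs2.isContDiff (by simp)), Pi.add_apply,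
    FunctionSpaces.Torus.partialDeriv_mul (hχ.isContDiff (by simp)) (hs1.isContDiff (by simp))]
  ring

end SliceCalculus

/-! ## The cubic identity on one time slice -/

section Slice

variable {K : UnitAddTorus d → ℝ} {v : UnitAddTorus d → EuclideanSpace ℝ d} {χ : UnitAddTorus d → ℝ}

omit [DecidableEq d] in
/-- A real function on the torus dominated by an integrable one through a continuous (hence
bounded) factor is integrable: `x ↦ f x * g x` for `f ∈ L¹`, `g` continuous. [folklore] -/
theorem integrable_mul_continuous {f g : UnitAddTorus d → ℝ} (hf : Integrable f volume)
    (hg : Continuous g) : Integrable (fun x => f x * g x) volume := by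
  obtain ⟨C, hC⟩ := FunctionSpaces.Torus.exists_forall_norm_le_of_continuous hg
  exact hf.mul_bdd hg.aestronglyMeasurable (ae_of_all _ fun x => hC x)

omit [DecidableEq d] in
/-- `x ↦ ⟪v x, g x⟫` is integrable for `v ∈ L¹` and `g` continuous. [folklore] -/
theorem integrable_inner_continuous (hv : Integrable v volume) {g : UnitAddTorus d → EuclideanSpace ℝ d}
    (hg : Continuous g) : Integrable (fun x => ⟪v x, g x⟫) volume := by
  obtain ⟨C, hC⟩ := FunctionSpaces.Torus.exists_forall_norm_le_of_continuous hg
  refine (hv.norm.mul_const C).mono' (hv.1.inner hg.aestronglyMeasurable) (ae_of_all _ fun x => ?_)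
  exact (norm_inner_le_norm _ _).trans (mul_le_mul_of_nonneg_left (hC x) (norm_nonneg _))

/-- **Duchon–Robert's cubic identity on a time slice**: for a smooth even kernel `K`, an `L³`
weakly divergence-free field `v` and a smooth cut-off `χ`,
`∫ 𝒟_K(v) χ = ∫⟪(|v|²v) ⋆ K, ∇χ⟫ − ∫(|v|² ⋆ K)⟪v,∇χ⟫ + 2∫⟪v, v ⋆ K⟫⟪v,∇χ⟫ − 2∫⟪v,(v·∇)Φ⟫`,
`Φ = χ(v ⋆ K) + (χv) ⋆ K` (the pointwise identity `kernelFlux_eq_sum` integrated against `χ`: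
integration by parts for the first term, weak divergence-freeness for the third, the odd
adjointness `∫ f (g ⋆ ∂ⱼK) = -∫ (f ⋆ ∂ⱼK) g` for the second, and the coordinate expansion of
`⟪v,(v·∇)Φ⟫`; Duchon–Robert 2000, proof of Prop. 1, pp. 250–251). [cite: DuchonRobert2000, proof of Prop. 1 pp. 250–251] -/
theorem integral_kernelFlux_mul_slice (hK : FunctionSpaces.Torus.IsSmooth K) (hKev : ∀ z, K (-z) = K z)
    (hv : MemLp v 3 volume) (hdiv : FunctionSpaces.Torus.IsWeaklyDivFree v)
    (hχ : FunctionSpaces.Torus.IsSmooth χ) :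
    ∫ x, kernelFlux K v x * χ x =
      (∫ x, ⟪vecConv (fun y => ‖v y‖ ^ 2 • v y) K x, FunctionSpaces.Torus.gradient χ x⟫) -
      (∫ x, ((fun y => ‖v y‖ ^ 2) ⋆ K) x * ⟪v x, FunctionSpaces.Torus.gradient χ x⟫) +
      2 * (∫ x, ⟪v x, vecConv v K x⟫ * ⟪v x, FunctionSpaces.Torus.gradient χ x⟫) -
      2 * ∫ x, ⟪v x, FunctionSpaces.Torus.convect v (symmTestField K χ v) x⟫ := by
  obtain ⟨I3, I2, I1⟩ := MemLp.integrable_norm_pow_three_and_sq hv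
  have hK1 : FunctionSpaces.Torus.IsContDiff 1 K := hK.isContDiff (by simp)
  have hχ1 : FunctionSpaces.Torus.IsContDiff 1 χ := hχ.isContDiff (by simp)
  have hvi : ∀ i, Integrable (fun y => v y i) volume := fun i => I1.eval_piLp i
  have hprod : ∀ i j, Integrable (fun y => v y i * v y j) volume :=
    fun i j => integrable_apply_mul_apply hv.1 I2 i j
  have hχvi : ∀ i, Integrable (fun y => χ y * v y i) volume := fun i => hχ.integrable_smul (hvi i)
  have hmi : ∀ k, AEStronglyMeasurable (fun y => v y k) volume := fun k =>
    (EuclideanSpace.proj (𝕜 := ℝ) k).continuous.comp_aestronglyMeasurable hv.1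
  -- the smooth fields involved
  have iG₁ : Integrable (fun y => ‖v y‖ ^ 2 • v y) volume := by
    refine I3.mono' ((hv.1.norm.pow 2).smul hv.1) (ae_of_all _ fun y => le_of_eq ?_)
    rw [norm_smul, Real.norm_eq_abs, abs_of_nonneg (sq_nonneg _)]
    ring
  set W := vecConv (fun y => ‖v y‖ ^ 2 • v y) K with hWdef
  set F := (fun y => ‖v y‖ ^ 2) ⋆ K with hFdef
  set Φ := symmTestField K χ v with hΦdef
  have hW : FunctionSpaces.Torus.IsSmooth W := isSmooth_vecConv iG₁ hK
  have hF : FunctionSpaces.Torus.IsSmooth F := FunctionSpaces.Torus.isSmooth_convolution I2 hK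
  have hΦ : FunctionSpaces.Torus.IsSmooth Φ := isSmooth_symmTestField hK hχ I1
  have hvK : ∀ i, FunctionSpaces.Torus.IsSmooth ((fun y => v y i) ⋆ K) := fun i =>
    FunctionSpaces.Torus.isSmooth_convolution (hvi i) hK
  have hχvK : ∀ i, FunctionSpaces.Torus.IsSmooth ((fun y => χ y * v y i) ⋆ K) := fun i =>
    FunctionSpaces.Torus.isSmooth_convolution (hχvi i) hK
  have hC : ∀ i j, Continuous ((fun y => v y i * v y j) ⋆ FunctionSpaces.Torus.partialDeriv j K) :=
    fun i j => (FunctionSpaces.Torus.isSmooth_convolution (hprod i j) (hK.partialDeriv j)).continuous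
  -- the four `x`-integrands
  set A : UnitAddTorus d → ℝ := fun x => FunctionSpaces.Torus.divergence W x * χ x with hA
  set B : UnitAddTorus d → ℝ := fun x => χ x * ∑ i, ∑ j, v x i *
    ((fun y => v y i * v y j) ⋆ FunctionSpaces.Torus.partialDeriv j K) x with hB
  set Q : UnitAddTorus d → ℝ := fun x => χ x * ⟪v x, FunctionSpaces.Torus.gradient F x⟫ with hQ
  set S : UnitAddTorus d → ℝ := fun x => χ x * ∑ i, ∑ j, v x i * v x j *
    FunctionSpaces.Torus.partialDeriv j ((fun y => v y i) ⋆ K) x with hS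
  obtain ⟨Cχ, hCχ⟩ := FunctionSpaces.Torus.exists_forall_norm_le_of_continuous hχ.continuous
  have iA : Integrable A volume :=
    ((hW.divergence.continuous).mul hχ.continuous).integrable_unitAddTorus
  have iB : Integrable B volume := by
    have h0 : Integrable (fun x => ∑ i, ∑ j, v x i *
        ((fun y => v y i * v y j) ⋆ FunctionSpaces.Torus.partialDeriv j K) x) volume :=
      integrable_finsetSum _ fun i _ => integrable_finsetSum _ fun j _ =>
        integrable_mul_continuous (hvi i) (hC i j)
    exact h0.bdd_mul hχ.continuous.aestronglyMeasurable (ae_of_all _ hCχ)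
  have iQ : Integrable Q volume :=
    (integrable_inner_continuous I1 hF.gradient.continuous).bdd_mul
      hχ.continuous.aestronglyMeasurable (ae_of_all _ hCχ)
  have iS : Integrable S volume := by
    have h0 : Integrable (fun x => ∑ i, ∑ j, v x i * v x j *
        FunctionSpaces.Torus.partialDeriv j ((fun y => v y i) ⋆ K) x) volume :=
      integrable_finsetSum _ fun i _ => integrable_finsetSum _ fun j _ =>
        integrable_mul_continuous (hprod i j) ((hvK i).partialDeriv j).continuous
    exact h0.bdd_mul hχ.continuous.aestronglyMeasurable (ae_of_all _ hCχ)
  -- Step 1: the pointwise identity, multiplied by `χ`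
  have hWsum : ∀ x, FunctionSpaces.Torus.divergence W x =
      ∑ j, ((fun y => ‖v y‖ ^ 2 * v y j) ⋆ FunctionSpaces.Torus.partialDeriv j K) x := by
    intro x
    rw [hWdef, divergence_vecConv_eq_sum hK iG₁]
    rfl
  have hpt : ∀ x, kernelFlux K v x * χ x = -A x + 2 * B x + Q x - 2 * S x := by
    intro x
    rw [kernelFlux_eq_sum hK hKev hv hdiv x]
    simp only [hA, hB, hQ, hS, hWsum, hFdef]
    ring
  have hAn : Integrable (fun x => -A x) volume := iA.neg
  have h1 : Integrable (fun x => -A x + 2 * B x) volume := hAn.add (iB.const_mul 2)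
  have h2 : Integrable (fun x => -A x + 2 * B x + Q x) volume := h1.add iQ
  rw [integral_congr_ae (ae_of_all _ hpt), integral_sub h2 (iS.const_mul 2), integral_add h1 iQ,
    integral_add hAn (iB.const_mul 2), integral_neg, integral_const_mul, integral_const_mul]
  -- Step 2: `-∫ A = ∫ ⟪W, ∇χ⟫` (integration by parts)
  have eA : ∫ x, A x = -∫ x, ⟪W x, FunctionSpaces.Torus.gradient χ x⟫ := by
    rw [FunctionSpaces.Torus.integral_inner_gradient_eq_neg_integral_mul_divergence_holds hW hχ,
      neg_neg]
    exact integral_congr_ae (ae_of_all _ fun x => mul_comm _ _)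
  -- Step 3: `∫ B = -∫ G3` (odd adjointness), `G3 = ∑ᵢⱼ ∂ⱼ((χvᵢ) ⋆ K) vᵢ vⱼ`
  set G3 : UnitAddTorus d → ℝ := fun y => ∑ i, ∑ j,
    FunctionSpaces.Torus.partialDeriv j ((fun z => χ z * v z i) ⋆ K) y * (v y i * v y j) with hG3
  have iG3 : Integrable G3 volume := by
    refine integrable_finsetSum _ fun i _ => integrable_finsetSum _ fun j _ => ?_
    simpa only [mul_comm] using integrable_mul_continuous (hprod i j) ((hχvK i).partialDeriv j).continuous
  have iBij : ∀ i j, Integrable (fun x => χ x * v x i *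
      ((fun y => v y i * v y j) ⋆ FunctionSpaces.Torus.partialDeriv j K) x) volume :=
    fun i j => integrable_mul_continuous (hχvi i) (hC i j)
  have iG3ij : ∀ i j, Integrable (fun y =>
      FunctionSpaces.Torus.partialDeriv j ((fun z => χ z * v z i) ⋆ K) y * (v y i * v y j)) volume := by
    intro i j
    simpa only [mul_comm] using integrable_mul_continuous (hprod i j) ((hχvK i).partialDeriv j).continuous
  have hodd : ∀ i j, ∫ x, χ x * v x i *
      ((fun y => v y i * v y j) ⋆ FunctionSpaces.Torus.partialDeriv j K) x =
      -∫ y, FunctionSpaces.Torus.partialDeriv j ((fun z => χ z * v z i) ⋆ K) y * (v y i * v y j) := by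
    intro i j
    rw [integral_mul_convolution_odd (hχvi i) (hprod i j) (hK.partialDeriv j).continuous
      (partialDeriv_neg_of_even hK1 hKev j)]
    congr 1
    refine integral_congr_ae (ae_of_all _ fun y => ?_)
    dsimp only
    rw [FunctionSpaces.Torus.partialDeriv_convolution (hχvi i) hK]
  have hBsum : ∀ x, B x = ∑ i, ∑ j, χ x * v x i *
      ((fun y => v y i * v y j) ⋆ FunctionSpaces.Torus.partialDeriv j K) x := by
    intro x
    simp only [hB, Finset.mul_sum]
    exact Finset.sum_congr rfl fun i _ => Finset.sum_congr rfl fun j _ => by ring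
  have eB : ∫ x, B x = -∫ y, G3 y := by
    rw [integral_congr_ae (ae_of_all _ hBsum)]
    simp only [hG3]
    rw [integral_finsetSum _ fun i _ => integrable_finsetSum _ fun j _ => iBij i j,
      integral_finsetSum _ fun i _ => integrable_finsetSum _ fun j _ => iG3ij i j,
      ← Finset.sum_neg_distrib]
    refine Finset.sum_congr rfl fun i _ => ?_
    rw [integral_finsetSum _ fun j _ => iBij i j, integral_finsetSum _ fun j _ => iG3ij i j,
      ← Finset.sum_neg_distrib]
    exact Finset.sum_congr rfl fun j _ => hodd i j
  -- Step 4: `∫ Q = -∫ F ⟪v, ∇χ⟫` (weak divergence-freeness against `F χ`)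
  have iFg : Integrable (fun x => F x * ⟪v x, FunctionSpaces.Torus.gradient χ x⟫) volume := by
    simpa only [mul_comm] using integrable_mul_continuous
      (integrable_inner_continuous I1 hχ.gradient.continuous) hF.continuous
  have eQ : ∫ x, Q x = -∫ x, F x * ⟪v x, FunctionSpaces.Torus.gradient χ x⟫ := by
    have h0 := hdiv (fun y => F y * χ y) (hF.smul' hχ)
    have hgrad : ∀ x, ⟪v x, FunctionSpaces.Torus.gradient (fun y => F y * χ y) x⟫ =
        F x * ⟪v x, FunctionSpaces.Torus.gradient χ x⟫ + Q x := by
      intro x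
      rw [gradient_mul_of_isContDiff (hF.isContDiff (by simp)) hχ1, inner_add_right, real_inner_smul_right,
        real_inner_smul_right]
    simp_rw [hgrad] at h0
    rw [integral_add iFg iQ] at h0
    linarith
  -- Step 5: the convective pairing in coordinates
  have iE : Integrable (fun x => ⟪v x, vecConv v K x⟫ * ⟪v x, FunctionSpaces.Torus.gradient χ x⟫) volume := by
    obtain ⟨C₁, hC₁⟩ := FunctionSpaces.Torus.exists_forall_norm_le_of_continuous (isSmooth_vecConv I1 hK).continuous
    obtain ⟨C₂, hC₂⟩ := FunctionSpaces.Torus.exists_forall_norm_le_of_continuous hχ.gradient.continuous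
    refine (I2.const_mul (C₁ * C₂)).mono'
      ((hv.1.inner (isSmooth_vecConv I1 hK).continuous.aestronglyMeasurable).mul
        (hv.1.inner hχ.gradient.continuous.aestronglyMeasurable)) (ae_of_all _ fun x => ?_)
    rw [norm_mul]
    have h1 : ‖⟪v x, vecConv v K x⟫‖ ≤ ‖v x‖ * C₁ :=
      (norm_inner_le_norm _ _).trans (mul_le_mul_of_nonneg_left (hC₁ x) (norm_nonneg _))
    have h2 : ‖⟪v x, FunctionSpaces.Torus.gradient χ x⟫‖ ≤ ‖v x‖ * C₂ :=
      (norm_inner_le_norm _ _).trans (mul_le_mul_of_nonneg_left (hC₂ x) (norm_nonneg _))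
    have hC₁0 : 0 ≤ C₁ := (norm_nonneg _).trans (hC₁ x)
    calc ‖⟪v x, vecConv v K x⟫‖ * ‖⟪v x, FunctionSpaces.Torus.gradient χ x⟫‖
        ≤ (‖v x‖ * C₁) * (‖v x‖ * C₂) := mul_le_mul h1 h2 (norm_nonneg _) (by positivity)
      _ = C₁ * C₂ * ‖v x‖ ^ 2 := by ring
  have hconv : ∀ x, ⟪v x, FunctionSpaces.Torus.convect v Φ x⟫ =
      ⟪v x, vecConv v K x⟫ * ⟪v x, FunctionSpaces.Torus.gradient χ x⟫ + S x + G3 x := by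
    intro x
    rw [inner_convect_eq_sum (hΦ.isContDiff (by simp)) (v x) v x]
    simp only [hΦdef, partialDeriv_symmTestField hK hχ I1, hS, hG3]
    rw [inner_eq_sum_mul (v x) (vecConv v K x), inner_eq_sum_mul (v x),
      Finset.sum_mul_sum]
    simp only [vecConv_apply, FunctionSpaces.Torus.gradient_apply hχ1, Finset.mul_sum, mul_add,
      Finset.sum_add_distrib]
    have e1 : ∑ j, ∑ i, v x j * (v x i * (FunctionSpaces.Torus.partialDeriv i χ x *
        ((fun y => v y j) ⋆ K) x)) =
        ∑ i, ∑ j, v x i * ((fun y => v y i) ⋆ K) x * (v x j * FunctionSpaces.Torus.partialDeriv j χ x) := by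
      refine Finset.sum_congr rfl fun j _ => Finset.sum_congr rfl fun i _ => by ring
    have e2 : ∑ j, ∑ i, v x j * (v x i * (χ x *
        FunctionSpaces.Torus.partialDeriv i ((fun y => v y j) ⋆ K) x)) =
        ∑ i, ∑ j, χ x * (v x i * v x j * FunctionSpaces.Torus.partialDeriv j ((fun y => v y i) ⋆ K) x) := by
      refine Finset.sum_congr rfl fun j _ => Finset.sum_congr rfl fun i _ => by ring
    have e3 : ∑ j, ∑ i, v x j * (v x i *
        FunctionSpaces.Torus.partialDeriv i ((fun z => χ z * v z j) ⋆ K) x) =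
        ∑ i, ∑ j, FunctionSpaces.Torus.partialDeriv j ((fun z => χ z * v z i) ⋆ K) x * (v x i * v x j) := by
      refine Finset.sum_congr rfl fun j _ => Finset.sum_congr rfl fun i _ => by ring
    rw [e1, e2, e3]
  have iES : Integrable (fun x => ⟪v x, vecConv v K x⟫ * ⟪v x, FunctionSpaces.Torus.gradient χ x⟫ + S x)
      volume := iE.add iS
  have econv : ∫ x, ⟪v x, FunctionSpaces.Torus.convect v Φ x⟫ =
      (∫ x, ⟪v x, vecConv v K x⟫ * ⟪v x, FunctionSpaces.Torus.gradient χ x⟫) +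
        (∫ x, S x) + ∫ x, G3 x := by
    rw [integral_congr_ae (ae_of_all _ hconv), integral_add iES iG3, integral_add iE iS]
  rw [eA, eB, eQ, econv]
  ring

end Slice

/-! ## Space–time bookkeeping: Hölder in the slices, dominations, Fubini -/

section SpaceTime

variable {T : ℝ} {u : ℝ → UnitAddTorus d → EuclideanSpace ℝ d} {K : UnitAddTorus d → ℝ}
  {ψ : ℝ → UnitAddTorus d → ℝ}

omit [DecidableEq d] in
/-- **Lyapunov on the probability space `T^d`**: `(∫|f|²)(∫|f|) ≤ ∫|f|³` (monotonicity of
`L^p` norms in the exponent, `eLpNorm_le_eLpNorm_of_exponent_le`). [folklore] -/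
theorem lintegral_sq_mul_lintegral_le {F : Type*} [NormedAddCommGroup F] {f : UnitAddTorus d → F}
    (hf : AEStronglyMeasurable f volume) :
    (∫⁻ y, ‖f y‖ₑ ^ 2) * (∫⁻ y, ‖f y‖ₑ) ≤ ∫⁻ y, ‖f y‖ₑ ^ 3 := by
  have h1 : eLpNorm f 1 volume ≤ eLpNorm f 3 volume :=
    eLpNorm_le_eLpNorm_of_exponent_le (by norm_num) hf
  have h2 : eLpNorm f 2 volume ≤ eLpNorm f 3 volume :=
    eLpNorm_le_eLpNorm_of_exponent_le (by norm_num) hf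
  rw [eLpNorm_one_eq_lintegral_enorm] at h1
  rw [eLpNorm_eq_lintegral_rpow_enorm_toReal two_ne_zero ENNReal.ofNat_ne_top] at h2
  rw [eLpNorm_eq_lintegral_rpow_enorm_toReal three_ne_zero ENNReal.ofNat_ne_top] at h1 h2
  simp only [ENNReal.toReal_ofNat, one_div] at h1 h2
  set A3 : ℝ≥0∞ := ∫⁻ y, ‖f y‖ₑ ^ (3 : ℝ) with hA3
  have e2 : (∫⁻ y, ‖f y‖ₑ ^ 2) = ∫⁻ y, ‖f y‖ₑ ^ (2 : ℝ) := by
    refine lintegral_congr fun y => ?_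
    rw [← ENNReal.rpow_natCast]; norm_num
  have e3 : (∫⁻ y, ‖f y‖ₑ ^ 3) = A3 := by
    refine lintegral_congr fun y => ?_
    rw [← ENNReal.rpow_natCast]; norm_num
  rw [e2, e3]
  have h2' : (∫⁻ y, ‖f y‖ₑ ^ (2 : ℝ)) ≤ A3 ^ (2 / 3 : ℝ) := by
    have := ENNReal.rpow_le_rpow h2 (by norm_num : (0 : ℝ) ≤ 2)
    rw [← ENNReal.rpow_mul, ← ENNReal.rpow_mul] at this
    norm_num at this
    rwa [e2] at this
  calc (∫⁻ y, ‖f y‖ₑ ^ (2 : ℝ)) * (∫⁻ y, ‖f y‖ₑ) ≤ A3 ^ (2 / 3 : ℝ) * A3 ^ (3⁻¹ : ℝ) :=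
        mul_le_mul' h2' h1
    _ = A3 := by
        rw [← ENNReal.rpow_add_of_nonneg _ _ (by norm_num) (by norm_num)]
        norm_num

/-- Pointwise bound for the mollification of an integrable vector field by a bounded kernel:
`‖(F ⋆ K)(x)‖ ≤ #d · C · ∫‖F‖` (`Torus.norm_le_sum_norm_apply` and `Torus.norm_convolution_le`
componentwise). [folklore] -/
theorem norm_vecConv_le {F : UnitAddTorus d → EuclideanSpace ℝ d} (hF : Integrable F volume)
    {C : ℝ} (hC : ∀ x, ‖K x‖ ≤ C) (x : UnitAddTorus d) :
    ‖vecConv F K x‖ ≤ Fintype.card d * (C * ∫ y, ‖F y‖) := by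
  have hC0 : 0 ≤ C := (norm_nonneg _).trans (hC 0)
  calc ‖vecConv F K x‖ ≤ ∑ j, ‖vecConv F K x j‖ := norm_le_sum_norm_apply _
    _ ≤ ∑ _j : d, C * ∫ y, ‖F y‖ := Finset.sum_le_sum fun j _ => by
        rw [vecConv_apply]
        refine (FunctionSpaces.Torus.norm_convolution_le (hF.eval_piLp j) hC x).trans ?_
        refine mul_le_mul_of_nonneg_left (integral_mono (hF.eval_piLp j).norm hF.norm fun y => ?_) hC0
        exact PiLp.norm_apply_le (F y) j
    _ = Fintype.card d * (C * ∫ y, ‖F y‖) := by simp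

omit [Fintype d] [DecidableEq d] in
/-- A property holding for a.e. `t` and all `x` holds a.e. on the product. [folklore] -/
theorem ae_prod_of_ae_left {β : Type*} [MeasurableSpace β] {μ : Measure ℝ} {ν : Measure β}
    [SFinite ν] {P : ℝ × β → Prop} (h : ∀ᵐ t ∂μ, ∀ x, P (t, x)) : ∀ᵐ z ∂(μ.prod ν), P z := by
  rw [ae_iff] at h ⊢
  have hsub : {z : ℝ × β | ¬P z} ⊆ {t | ¬∀ x, P (t, x)} ×ˢ (univ : Set β) := by
    rintro ⟨t, x⟩ hz
    exact ⟨fun hall => hz (hall x), mem_univ _⟩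
  refine measure_mono_null hsub ?_
  rw [Measure.prod_prod, h, zero_mul]

omit [DecidableEq d] in
/-- **The slice-functional dominations are integrable** on `(0,T) × T^d` for `u ∈ L³_{t,x}`:
`(t,x) ↦ ∫|u(t)|³`, `(t,x) ↦ (∫|u(t)|²)|u(t,x)|` and `(t,x) ↦ (∫|u(t)|)|u(t,x)|²`
(Tonelli and Lyapunov's inequality in the slices). [folklore] -/
theorem integrable_slice_dominations
    (hum : AEStronglyMeasurable (uncurry u) ((volume.restrict (Ioo 0 T)).prod volume))
    (hu3 : ∫⁻ t in Ioo 0 T, ∫⁻ x, ‖u t x‖ₑ ^ 3 < ⊤) :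
    Integrable (fun z : ℝ × UnitAddTorus d => ∫ y, ‖u z.1 y‖ ^ 3)
        ((volume.restrict (Ioo 0 T)).prod volume) ∧
      Integrable (fun z : ℝ × UnitAddTorus d => (∫ y, ‖u z.1 y‖ ^ 2) * ‖u z.1 z.2‖)
        ((volume.restrict (Ioo 0 T)).prod volume) ∧
      Integrable (fun z : ℝ × UnitAddTorus d => (∫ y, ‖u z.1 y‖) * ‖u z.1 z.2‖ ^ 2)
        ((volume.restrict (Ioo 0 T)).prod volume) := by
  set μ : Measure ℝ := volume.restrict (Ioo 0 T) with hμ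
  set μT := μ.prod (volume : Measure (UnitAddTorus d)) with hμT
  have e3 : ∫⁻ t in Ioo 0 T, ∫⁻ x, ‖u t x‖ₑ ^ (3 : ℕ) = ∫⁻ z, ‖u z.1 z.2‖ₑ ^ (3 : ℕ) ∂μT :=
    lintegral_Ioo_lintegral_eq_lintegral_prod (hum.enorm.pow_const _)
  have I3 : Integrable (fun z : ℝ × UnitAddTorus d => ‖u z.1 z.2‖ ^ 3) μT := by
    have h := integrable_norm_pow_three hum (by rwa [e3] at hu3)
    exact h
  have hslice : ∀ᵐ t ∂μ, AEStronglyMeasurable (u t) volume := hum.prodMk_left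
  -- (1) `∫|u(t)|³`
  have D1 : Integrable (fun z : ℝ × UnitAddTorus d => ∫ y, ‖u z.1 y‖ ^ 3) μT :=
    I3.integral_prod_left.comp_fst volume
  have hg2 : ∀ t, ‖∫ y, ‖u t y‖ ^ 2‖ₑ ≤ ∫⁻ y, ‖u t y‖ₑ ^ 2 := fun t =>
    (enorm_integral_le_lintegral_enorm _).trans (le_of_eq (lintegral_congr fun y => enorm_norm_pow _ _))
  have hg1 : ∀ t, ‖∫ y, ‖u t y‖‖ₑ ≤ ∫⁻ y, ‖u t y‖ₑ := fun t =>
    (enorm_integral_le_lintegral_enorm _).trans (le_of_eq (lintegral_congr fun y => enorm_norm _))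
  refine ⟨D1, ?_, ?_⟩
  · -- (2) `(∫|u(t)|²)|u(t,x)|`
    have hN2 : AEStronglyMeasurable (fun t => ∫ y, ‖u t y‖ ^ 2) μ :=
      ((hum.norm.pow 2)).integral_prod_right'
    refine ⟨(hN2.comp_fst).mul hum.norm, ?_⟩
    have hmeas : AEMeasurable (fun z : ℝ × UnitAddTorus d => ‖∫ y, ‖u z.1 y‖ ^ 2‖ₑ * ‖u z.1 z.2‖ₑ) μT :=
      (hN2.comp_fst).enorm.mul hum.enorm
    calc ∫⁻ z, ‖(∫ y, ‖u z.1 y‖ ^ 2) * ‖u z.1 z.2‖‖ₑ ∂μT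
        = ∫⁻ z, ‖∫ y, ‖u z.1 y‖ ^ 2‖ₑ * ‖u z.1 z.2‖ₑ ∂μT := by
          refine lintegral_congr fun z => ?_
          rw [enorm_mul, enorm_norm]
      _ = ∫⁻ t, ‖∫ y, ‖u t y‖ ^ 2‖ₑ * (∫⁻ x, ‖u t x‖ₑ) ∂μ := by
          rw [lintegral_prod _ hmeas]
          refine lintegral_congr_ae (hslice.mono fun t ht => ?_)
          show ∫⁻ y, ‖∫ y', ‖u t y'‖ ^ 2‖ₑ * ‖u t y‖ₑ = _
          exact lintegral_const_mul'' _ ht.enorm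
      _ ≤ ∫⁻ t, (∫⁻ x, ‖u t x‖ₑ ^ 3) ∂μ := by
          refine lintegral_mono_ae (hslice.mono fun t ht => ?_)
          exact (mul_le_mul' (hg2 t) le_rfl).trans (lintegral_sq_mul_lintegral_le ht)
      _ < ⊤ := hu3
  · -- (3) `(∫|u(t)|)|u(t,x)|²`
    have hN1 : AEStronglyMeasurable (fun t => ∫ y, ‖u t y‖) μ := hum.norm.integral_prod_right'
    refine ⟨(hN1.comp_fst).mul (hum.norm.pow 2), ?_⟩
    have hmeas : AEMeasurable (fun z : ℝ × UnitAddTorus d => ‖∫ y, ‖u z.1 y‖‖ₑ * ‖u z.1 z.2‖ₑ ^ 2) μT :=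
      (hN1.comp_fst).enorm.mul (hum.enorm.pow_const 2)
    calc ∫⁻ z, ‖(∫ y, ‖u z.1 y‖) * ‖u z.1 z.2‖ ^ 2‖ₑ ∂μT
        = ∫⁻ z, ‖∫ y, ‖u z.1 y‖‖ₑ * ‖u z.1 z.2‖ₑ ^ 2 ∂μT := by
          refine lintegral_congr fun z => ?_
          rw [enorm_mul, enorm_norm_pow]
      _ = ∫⁻ t, ‖∫ y, ‖u t y‖‖ₑ * (∫⁻ x, ‖u t x‖ₑ ^ 2) ∂μ := by
          rw [lintegral_prod _ hmeas]
          refine lintegral_congr_ae (hslice.mono fun t ht => ?_)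
          show ∫⁻ y, ‖∫ y', ‖u t y'‖‖ₑ * ‖u t y‖ₑ ^ 2 = _
          exact lintegral_const_mul'' _ (ht.enorm.pow_const 2)
      _ ≤ ∫⁻ t, (∫⁻ x, ‖u t x‖ₑ ^ 3) ∂μ := by
          refine lintegral_mono_ae (hslice.mono fun t ht => ?_)
          rw [mul_comm]
          exact (mul_le_mul' le_rfl (hg1 t)).trans (lintegral_sq_mul_lintegral_le ht)
      _ < ⊤ := hu3

omit [DecidableEq d] in
/-- Pointwise bound for the Duchon–Robert flux through a kernel with bounded gradient:
`|𝒟_K(v)(x)| ≤ 4C (∫|v|³ + |v(x)|³)` for `v ∈ L³`. [folklore] -/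
theorem abs_kernelFlux_le {v : UnitAddTorus d → EuclideanSpace ℝ d} (hv : MemLp v 3 volume)
    {C : ℝ} (hC : ∀ z, ‖FunctionSpaces.Torus.gradient K z‖ ≤ C) (x : UnitAddTorus d) :
    |kernelFlux K v x| ≤ 4 * C * ((∫ y, ‖v y‖ ^ 3) + ‖v x‖ ^ 3) := by
  obtain ⟨I3, -, -⟩ := MemLp.integrable_norm_pow_three_and_sq hv
  have hC0 : 0 ≤ C := (norm_nonneg _).trans (hC 0)
  have hint : Integrable (fun z => 4 * C * (‖v (x + z)‖ ^ 3 + ‖v x‖ ^ 3)) volume :=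
    ((I3.comp_add_left x).add (integrable_const _)).const_mul _
  rw [kernelFlux, ← Real.norm_eq_abs]
  refine (norm_integral_le_integral_norm _).trans ?_
  calc ∫ z, ‖⟪FunctionSpaces.Torus.gradient K z, v (x + z) - v x⟫ * ‖v (x + z) - v x‖ ^ 2‖
      ≤ ∫ z, 4 * C * (‖v (x + z)‖ ^ 3 + ‖v x‖ ^ 3) := by
        refine integral_mono_of_nonneg (ae_of_all _ fun z => norm_nonneg _) hint
          (ae_of_all _ fun z => ?_)
        have h3 := norm_sub_pow_three_le (v (x + z)) (v x)
        dsimp only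
        rw [norm_mul, norm_pow, norm_norm]
        calc ‖⟪FunctionSpaces.Torus.gradient K z, v (x + z) - v x⟫‖ * ‖v (x + z) - v x‖ ^ 2
            ≤ (C * ‖v (x + z) - v x‖) * ‖v (x + z) - v x‖ ^ 2 := by
              gcongr
              exact (norm_inner_le_norm _ _).trans (mul_le_mul_of_nonneg_right (hC z) (norm_nonneg _))
          _ = C * ‖v (x + z) - v x‖ ^ 3 := by ring
          _ ≤ C * (4 * (‖v (x + z)‖ ^ 3 + ‖v x‖ ^ 3)) := mul_le_mul_of_nonneg_left h3 hC0
          _ = 4 * C * (‖v (x + z)‖ ^ 3 + ‖v x‖ ^ 3) := by ring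
    _ = 4 * C * ((∫ y, ‖v y‖ ^ 3) + ‖v x‖ ^ 3) := by
        rw [integral_const_mul, integral_add (I3.comp_add_left x) (integrable_const _),
          integral_add_left_eq_self (fun y => ‖v y‖ ^ 3) x, integral_const, smul_eq_mul]
        simp

/-- **Discharge of `Torus.integral_kernelFlux_mul_eq`** (Duchon–Robert 2000, proof of Prop. 1,
pp. 250–251, the cubic identity, on `(0,T) × T^d`): the slice identity
`integral_kernelFlux_mul_slice` for a.e. `t`, integrated in time; the four right-hand
integrands are integrable on `(0,T) × T^d` by the dominations
`|⟪(|u|²u) ⋆ K, ∇ψ⟫| ≲ ∫|u(t)|³`, `|(|u|² ⋆ K)⟪u,∇ψ⟫| ≲ (∫|u(t)|²)|u|`,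
`|⟪u, u ⋆ K⟫⟪u,∇ψ⟫| ≲ (∫|u(t)|)|u|²` (`integrable_slice_dominations`) and the flux itself by
`|𝒟_K(u)ψ| ≲ ∫|u(t)|³ + |u|³`, so that the time integral splits (Fubini). [cite: DuchonRobert2000, proof of Prop. 1 pp. 250–251] -/
theorem integral_kernelFlux_mul_eq_holds : integral_kernelFlux_mul_eq (d := d) := by
  intro T u hmeas hu3 hdiv K hK hKev ψ hψ
  set μ : Measure ℝ := volume.restrict (Ioo 0 T) with hμ
  set μT := μ.prod (volume : Measure (UnitAddTorus d)) with hμT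
  have hum : AEStronglyMeasurable (uncurry u) μT := aestronglyMeasurable_uncurry_prod hmeas
  have hslice3 : ∀ᵐ t ∂μ, MemLp (u t) 3 volume := ae_memLp_three_of_lintegral hum hu3
  have hK1 : FunctionSpaces.Torus.IsContDiff 1 K := hK.isContDiff (by simp)
  -- test-field data
  obtain ⟨hψs, -, hgr, -⟩ := hψ.isSpaceTimeTest.isSmoothSpaceTimeOn_derived
  obtain ⟨⟨Cψ, hCψ0, hCψ⟩, hψm⟩ := hψs.bound_and_measurable T
  obtain ⟨⟨Cg, hCg0, hCg⟩, hgm⟩ := hgr.bound_and_measurable T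
  -- kernel data
  obtain ⟨CK, hCK⟩ := FunctionSpaces.Torus.exists_forall_norm_le_of_continuous hK.continuous
  obtain ⟨CK', hCK'⟩ := FunctionSpaces.Torus.exists_forall_norm_le_of_continuous hK.gradient.continuous
  have hCK0 : 0 ≤ CK := (norm_nonneg _).trans (hCK 0)
  have hIoo : ∀ᵐ z ∂μT, z.1 ∈ Ioo 0 T := by
    rw [hμT, hμ, ← volume_restrict_Ioo_prod_univ]
    filter_upwards [ae_restrict_mem (measurableSet_Ioo.prod MeasurableSet.univ)] with z hz
    exact hz.1
  have hgood : ∀ᵐ z ∂μT, MemLp (u z.1) 3 volume :=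
    ae_prod_of_ae_left (hslice3.mono fun t ht => fun _ => ht)
  obtain ⟨D1, D2, D3⟩ := integrable_slice_dominations hum hu3
  have e3 : ∫⁻ t in Ioo 0 T, ∫⁻ x, ‖u t x‖ₑ ^ (3 : ℕ) = ∫⁻ z, ‖u z.1 z.2‖ₑ ^ (3 : ℕ) ∂μT :=
    lintegral_Ioo_lintegral_eq_lintegral_prod (hum.enorm.pow_const _)
  have I3 : Integrable (fun z : ℝ × UnitAddTorus d => ‖u z.1 z.2‖ ^ 3) μT :=
    integrable_norm_pow_three hum (by rwa [e3] at hu3)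
  -- measurability of the product integrands
  have hG2 : AEStronglyMeasurable (uncurry fun t y => ‖u t y‖ ^ 2 • u t y) μT :=
    (hum.norm.pow 2).smul hum
  have hΘ : AEStronglyMeasurable (uncurry fun t y => ‖u t y‖ ^ 2) μT := hum.norm.pow 2
  have mA : AEStronglyMeasurable (fun z : ℝ × UnitAddTorus d =>
      ⟪vecConv (fun y => ‖u z.1 y‖ ^ 2 • u z.1 y) K z.2, FunctionSpaces.Torus.gradient (ψ z.1) z.2⟫) μT :=
    (aestronglyMeasurable_uncurry_vecConv hG2 hK.continuous).inner hgm
  have mB : AEStronglyMeasurable (fun z : ℝ × UnitAddTorus d =>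
      ((fun y => ‖u z.1 y‖ ^ 2) ⋆ K) z.2 * ⟪u z.1 z.2, FunctionSpaces.Torus.gradient (ψ z.1) z.2⟫) μT :=
    (FunctionSpaces.Torus.aestronglyMeasurable_uncurry_convolution (ContinuousLinearMap.lsmul ℝ ℝ)
      hΘ hK.continuous).mul (hum.inner hgm)
  have mE : AEStronglyMeasurable (fun z : ℝ × UnitAddTorus d =>
      ⟪u z.1 z.2, vecConv (u z.1) K z.2⟫ * ⟪u z.1 z.2, FunctionSpaces.Torus.gradient (ψ z.1) z.2⟫) μT :=
    (hum.inner (aestronglyMeasurable_uncurry_vecConv hum hK.continuous)).mul (hum.inner hgm)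
  have mK : AEStronglyMeasurable (fun z : ℝ × UnitAddTorus d => kernelFlux K (u z.1) z.2 * ψ z.1 z.2) μT := by
    have hδ : AEStronglyMeasurable (fun q : (ℝ × UnitAddTorus d) × UnitAddTorus d =>
        u q.1.1 (q.1.2 + q.2) - u q.1.1 q.1.2) (μT.prod volume) :=
      (aestronglyMeasurable_translate (ν := volume) hum measurable_id).sub hum.comp_fst
    have hΨ : AEStronglyMeasurable (fun q : (ℝ × UnitAddTorus d) × UnitAddTorus d =>
        ⟪FunctionSpaces.Torus.gradient K q.2, u q.1.1 (q.1.2 + q.2) - u q.1.1 q.1.2⟫ *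
          ‖u q.1.1 (q.1.2 + q.2) - u q.1.1 q.1.2‖ ^ 2) (μT.prod volume) :=
      ((hK.gradient.continuous.aestronglyMeasurable.comp_snd).inner hδ).mul (hδ.norm.pow 2)
    exact hΨ.integral_prod_right'.mul hψm
  -- dominations, hence integrability
  have iA : Integrable (fun z : ℝ × UnitAddTorus d =>
      ⟪vecConv (fun y => ‖u z.1 y‖ ^ 2 • u z.1 y) K z.2, FunctionSpaces.Torus.gradient (ψ z.1) z.2⟫) μT := by
    refine (D1.const_mul (Fintype.card d * CK * Cg)).mono' mA ?_
    filter_upwards [hIoo, hgood] with z hz ht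
    obtain ⟨I3t, -, -⟩ := MemLp.integrable_norm_pow_three_and_sq ht
    have iG : Integrable (fun y => ‖u z.1 y‖ ^ 2 • u z.1 y) volume := by
      refine I3t.mono' ((ht.1.norm.pow 2).smul ht.1) (ae_of_all _ fun y => le_of_eq ?_)
      rw [norm_smul, Real.norm_eq_abs, abs_of_nonneg (sq_nonneg _)]
      ring
    have hnorm : ∫ y, ‖‖u z.1 y‖ ^ 2 • u z.1 y‖ = ∫ y, ‖u z.1 y‖ ^ 3 := by
      refine integral_congr_ae (ae_of_all _ fun y => ?_)
      dsimp only
      rw [norm_smul, Real.norm_eq_abs, abs_of_nonneg (sq_nonneg _)]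
      ring
    have hv := norm_vecConv_le iG hCK z.2
    rw [hnorm] at hv
    calc ‖⟪vecConv (fun y => ‖u z.1 y‖ ^ 2 • u z.1 y) K z.2, FunctionSpaces.Torus.gradient (ψ z.1) z.2⟫‖
        ≤ ‖vecConv (fun y => ‖u z.1 y‖ ^ 2 • u z.1 y) K z.2‖ * ‖FunctionSpaces.Torus.gradient (ψ z.1) z.2‖ :=
          norm_inner_le_norm _ _
      _ ≤ (Fintype.card d * (CK * ∫ y, ‖u z.1 y‖ ^ 3)) * Cg :=
          mul_le_mul hv (hCg z.1 (Ioo_subset_Icc_self hz) z.2) (norm_nonneg _) (by positivity)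
      _ = Fintype.card d * CK * Cg * ∫ y, ‖u z.1 y‖ ^ 3 := by ring
  have iB : Integrable (fun z : ℝ × UnitAddTorus d =>
      ((fun y => ‖u z.1 y‖ ^ 2) ⋆ K) z.2 * ⟪u z.1 z.2, FunctionSpaces.Torus.gradient (ψ z.1) z.2⟫) μT := by
    refine (D2.const_mul (CK * Cg)).mono' mB ?_
    filter_upwards [hIoo, hgood] with z hz ht
    obtain ⟨-, I2t, -⟩ := MemLp.integrable_norm_pow_three_and_sq ht
    have hconv : ‖((fun y => ‖u z.1 y‖ ^ 2) ⋆ K) z.2‖ ≤ CK * ∫ y, ‖u z.1 y‖ ^ 2 := by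
      have h := FunctionSpaces.Torus.norm_convolution_le I2t hCK z.2
      have hn : ∫ y, ‖‖u z.1 y‖ ^ 2‖ = ∫ y, ‖u z.1 y‖ ^ 2 :=
        integral_congr_ae (ae_of_all _ fun y => by
          dsimp only; rw [Real.norm_eq_abs, abs_of_nonneg (sq_nonneg _)])
      rwa [hn] at h
    have hi : ‖⟪u z.1 z.2, FunctionSpaces.Torus.gradient (ψ z.1) z.2⟫‖ ≤ ‖u z.1 z.2‖ * Cg :=
      (norm_inner_le_norm _ _).trans
        (mul_le_mul_of_nonneg_left (hCg z.1 (Ioo_subset_Icc_self hz) z.2) (norm_nonneg _))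
    have hN0 : 0 ≤ ∫ y, ‖u z.1 y‖ ^ 2 := integral_nonneg fun y => sq_nonneg _
    rw [norm_mul]
    calc ‖((fun y => ‖u z.1 y‖ ^ 2) ⋆ K) z.2‖ * ‖⟪u z.1 z.2, FunctionSpaces.Torus.gradient (ψ z.1) z.2⟫‖
        ≤ (CK * ∫ y, ‖u z.1 y‖ ^ 2) * (‖u z.1 z.2‖ * Cg) :=
          mul_le_mul hconv hi (norm_nonneg _) (by positivity)
      _ = CK * Cg * ((∫ y, ‖u z.1 y‖ ^ 2) * ‖u z.1 z.2‖) := by ring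
  have iE : Integrable (fun z : ℝ × UnitAddTorus d =>
      ⟪u z.1 z.2, vecConv (u z.1) K z.2⟫ * ⟪u z.1 z.2, FunctionSpaces.Torus.gradient (ψ z.1) z.2⟫) μT := by
    refine (D3.const_mul (Fintype.card d * CK * Cg)).mono' mE ?_
    filter_upwards [hIoo, hgood] with z hz ht
    have hv := norm_vecConv_le (ht.integrable (by norm_num)) hCK z.2
    have hi : ‖⟪u z.1 z.2, FunctionSpaces.Torus.gradient (ψ z.1) z.2⟫‖ ≤ ‖u z.1 z.2‖ * Cg :=
      (norm_inner_le_norm _ _).trans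
        (mul_le_mul_of_nonneg_left (hCg z.1 (Ioo_subset_Icc_self hz) z.2) (norm_nonneg _))
    have h1 : ‖⟪u z.1 z.2, vecConv (u z.1) K z.2⟫‖ ≤
        ‖u z.1 z.2‖ * (Fintype.card d * (CK * ∫ y, ‖u z.1 y‖)) :=
      (norm_inner_le_norm _ _).trans (mul_le_mul_of_nonneg_left hv (norm_nonneg _))
    have hN0 : 0 ≤ ∫ y, ‖u z.1 y‖ := integral_nonneg fun y => norm_nonneg _
    rw [norm_mul]
    calc ‖⟪u z.1 z.2, vecConv (u z.1) K z.2⟫‖ * ‖⟪u z.1 z.2, FunctionSpaces.Torus.gradient (ψ z.1) z.2⟫‖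
        ≤ (‖u z.1 z.2‖ * (Fintype.card d * (CK * ∫ y, ‖u z.1 y‖))) * (‖u z.1 z.2‖ * Cg) :=
          mul_le_mul h1 hi (norm_nonneg _) (by positivity)
      _ = Fintype.card d * CK * Cg * ((∫ y, ‖u z.1 y‖) * ‖u z.1 z.2‖ ^ 2) := by ring
  have iK : Integrable (fun z : ℝ × UnitAddTorus d => kernelFlux K (u z.1) z.2 * ψ z.1 z.2) μT := by
    refine ((D1.add I3).const_mul (4 * CK' * Cψ)).mono' mK ?_
    filter_upwards [hIoo, hgood] with z hz ht
    have hk := abs_kernelFlux_le ht hCK' z.2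
    have hψz : ‖ψ z.1 z.2‖ ≤ Cψ := hCψ z.1 (Ioo_subset_Icc_self hz) z.2
    have hCK'0 : 0 ≤ CK' := (norm_nonneg _).trans (hCK' 0)
    have hN0 : 0 ≤ (∫ y, ‖u z.1 y‖ ^ 3) + ‖u z.1 z.2‖ ^ 3 :=
      add_nonneg (integral_nonneg fun y => pow_nonneg (norm_nonneg _) _) (pow_nonneg (norm_nonneg _) _)
    rw [norm_mul, Real.norm_eq_abs]
    calc |kernelFlux K (u z.1) z.2| * ‖ψ z.1 z.2‖
        ≤ (4 * CK' * ((∫ y, ‖u z.1 y‖ ^ 3) + ‖u z.1 z.2‖ ^ 3)) * Cψ :=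
          mul_le_mul hk hψz (norm_nonneg _) (by positivity)
      _ = 4 * CK' * Cψ * ((∫ y, ‖u z.1 y‖ ^ 3) + ‖u z.1 z.2‖ ^ 3) := by ring
  -- the slice functionals are integrable in time
  have ia := iA.integral_prod_left
  have ib := iB.integral_prod_left
  have ie := iE.integral_prod_left
  have ik := iK.integral_prod_left
  -- the slice identity for a.e. `t`, and integrability of the convective term
  have hid : ∀ᵐ t ∂μ, (∫ x, kernelFlux K (u t) x * ψ t x) =
      (∫ x, ⟪vecConv (fun y => ‖u t y‖ ^ 2 • u t y) K x, FunctionSpaces.Torus.gradient (ψ t) x⟫) -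
      (∫ x, ((fun y => ‖u t y‖ ^ 2) ⋆ K) x * ⟪u t x, FunctionSpaces.Torus.gradient (ψ t) x⟫) +
      2 * (∫ x, ⟪u t x, vecConv (u t) K x⟫ * ⟪u t x, FunctionSpaces.Torus.gradient (ψ t) x⟫) -
      2 * ∫ x, ⟪u t x, FunctionSpaces.Torus.convect (u t) (symmTestField K (ψ t) (u t)) x⟫ := by
    filter_upwards [hslice3, hdiv] with t ht hdt
    exact integral_kernelFlux_mul_slice hK hKev ht hdt (hψ.isSpaceTimeTest.isSmooth_slice t)
  have ic : Integrable (fun t => ∫ x,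
      ⟪u t x, FunctionSpaces.Torus.convect (u t) (symmTestField K (ψ t) (u t)) x⟫) μ := by
    refine (((ia.sub ib).add (ie.const_mul 2)).sub ik).const_mul 2⁻¹ |>.congr ?_
    filter_upwards [hid] with t ht
    simp only [Pi.sub_apply, Pi.add_apply]
    rw [ht]
    ring
  -- splitting the time integral
  have h1 : Integrable (fun t =>
      (∫ x, ⟪vecConv (fun y => ‖u t y‖ ^ 2 • u t y) K x, FunctionSpaces.Torus.gradient (ψ t) x⟫) -
      (∫ x, ((fun y => ‖u t y‖ ^ 2) ⋆ K) x * ⟪u t x, FunctionSpaces.Torus.gradient (ψ t) x⟫)) μ :=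
    ia.sub ib
  have h2 : Integrable (fun t =>
      (∫ x, ⟪vecConv (fun y => ‖u t y‖ ^ 2 • u t y) K x, FunctionSpaces.Torus.gradient (ψ t) x⟫) -
      (∫ x, ((fun y => ‖u t y‖ ^ 2) ⋆ K) x * ⟪u t x, FunctionSpaces.Torus.gradient (ψ t) x⟫) +
      2 * (∫ x, ⟪u t x, vecConv (u t) K x⟫ * ⟪u t x, FunctionSpaces.Torus.gradient (ψ t) x⟫)) μ :=
    h1.add (ie.const_mul 2)
  rw [integral_congr_ae hid, integral_sub h2 (ic.const_mul 2), integral_add h1 (ie.const_mul 2),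
    integral_sub ia ib, integral_const_mul, integral_const_mul]

end SpaceTime

end Literature.Analysis.FluidPDE.Torus
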